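import Summits.BirchSwinnertonDyer.BirchSwinnertonDyer.Theorems.SignedLowerHalvesKobayashiMainConjectureSmallImageCMTransferRecordsA
import HarnessLib

/-!
# Route `SignedLowerHalves`, crux `KobayashiMainConjectureSmallImage` (item stmt-BirchSwinnertonDyer-19002) —
# the CM-congruence transfer line (L4-CM), UNIT CASE, part F: per-pair records 4 pairs at `p = 5` (partners `[0,0,0,0,−1372] : y² = x³ − 2²·7³` (`j = 0`, conductor `5292`) / `[0,0,0,0,4] : y² = x³ + 4` (`j = 0`, conductor `108`) / `[0,0,0,0,9604] : y² = x³ + 2²·7⁴` (`j = 0`, conductor `1764`) / `[0,0,0,0,907924] : y² = x³ + 2²·61³` (`j = 0`, conductor `401868`))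
# (cell `bsd-ssimc`, seat `bsd-ssimc-k3-c4` gen 2)

HONEST FRAMING: Kobayashi's signed main conjecture at a non-surjective (normaliser-of-non-split-Cartan) image is OPEN;
nothing here proves it for any class. Every record below is CONDITIONAL on the explicitly labelled OPEN binder
`CorpuzLei2025_signedMainConjecture_transfer_OPEN` (Corpuz–Lei, arXiv:2508.09733, 2025, UNREFEREED preprint), taken as
the hypothesis `hCL` and never asserted, and on PUBLISHED results consumed BY NAME (`hPR` Pollack–Rubin 2004; `h5`/`h3`
period-unit comparisons; at `p = 5` Fisher 2012 Thm. 13.2 `hF` / Fisher 2013 Thm. 5.8 `hF'` as named facts). Per pair; item 4 stays OPEN; nothing is booked; BSD is not proved by any of this.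

## What this file does (our own work, hence `Summits/…/Theorems`)

Part A (`…CMTransferRecordsA.lean`) proved the UNIT CASE of the line as a kernel theorem,
`kobayashiMainConjecture_of_cmPartner_of_lvalue_of_transfer_OPEN`: `E = W` (odd good `p`, `a_p = 0`, ANY image) with
a CM partner `E'` congruent mod `p` and ONE `L`-value certificate `L(E',1)/Ω(E') = q`, `ord_p q = 0` ⟹
`∀ ε, KobayashiMainConjecture W p ε` modulo the binder. This part instantiates it for 4 of the 23 unit-case
window pairs of the seat's census (k3c4 MEMO-1 add. E; certificates kit j250394 = PARI + the seat's exact Python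
re-derivation `work/hesse_cert.py`, 79/79): `197748b1 @ 5`, `322812m1 @ 5`, `401868k1 @ 5`, `421596m1 @ 5` — CM partner `[0,0,0,0,−1372] : y² = x³ − 2²·7³` (`j = 0`, conductor `5292`) / `[0,0,0,0,4] : y² = x³ + 4` (`j = 0`, conductor `108`) / `[0,0,0,0,9604] : y² = x³ + 2²·7⁴` (`j = 0`, conductor `1764`) / `[0,0,0,0,907924] : y² = x³ + 2²·61³` (`j = 0`, conductor `401868`). The CM partner data (point count at `p`, `Δ ≠ 0`, Kraus minimality, CM by `j`) of `[0,0,0,0,4] : y² = x³ + 4` (`j = 0`, conductor `108`), `[0,0,0,0,−1372] : y² = x³ − 2²·7³` (`j = 0`, conductor `5292`), `[0,0,0,0,907924] : y² = x³ + 2²·61³` (`j = 0`, conductor `401868`), `[0,0,0,0,9604] : y² = x³ + 2²·7⁴` (`j = 0`, conductor `1764`) are decided in THIS file (32a2's are in part A). The window curves' own ellipticity / minimality enter only as the instance binders `[W.IsElliptic] [W.IsGloballyMinimal]` (Cremona models). Per pair, DECIDED IN THE KERNEL from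
the two integer models: `p ∤ Δ`, `#Ẽ(𝔽_p) = #Ẽ'(𝔽_p) = p + 1` (`a_p = 0`), CM of
`E'` (`j ∈ cmJInvariants`), and the congruence `E[p] ≃ E'[p]`: modulo Fisher's named facts (`fiveCongruent_of_hesseCertificate` `hF` / `fiveCongruent_of_hesseIndCertificate` `hF'`; the two covariant identities by `norm_num`).
Displayed certificate binder per record: `hL'` = `L(E',1)/Ω(E') = q` (two engines: PARI `ellL1`/`omega`, kit j250436;
the cell's PARI-free modular-symbol engine `[0]⁺`, kit j251201); `q ≠ 0` and `ord_p q = 0` decided.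

References: [CorpuzLei2025] Thms 1–3; [PollackRubin2004] Thm. (p. 448); [Kobayashi2003] Conj. (p. 2), (3.6);
[Kurihara2002] Thm. 0.1; [GreenbergVatsal2000] (2), §3 Rem. 3.4; [Fisher2012Hessian] §8, §13, Thm. 13.2;
[Fisher2013QuinticTwists] Thm. 5.8; [SilvermanAEC2009] III §1, VII.1, App. C §11; [Cremona2006] Table 1.
-/

set_option autoImplicit false
set_option linter.dupNamespace false

noncomputable section

open scoped Classical MatrixGroups ModularForm

open CongruenceSubgroup WeierstrassCurve Literature.NumberTheory.EllipticCurves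
  Literature.NumberTheory.EllipticCurves.ModularForms
  Literature.NumberTheory.EllipticCurves.Kobayashi2003 ZpExtension
  Literature.NumberTheory.EllipticCurves.GreenbergVatsal2000
  Literature.NumberTheory.EllipticCurves.Rank1Residual
  Literature.NumberTheory.EllipticCurves.Rank1Residual.Typed
  Literature.NumberTheory.EllipticCurves.Rank1Residual.X11RankOneCertificates
  Literature.NumberTheory.EllipticCurves.Fisher2012
  Summit.BirchSwinnertonDyer.BirchSwinnertonDyer.Rank1Residual.IntModel
  Summit.BirchSwinnertonDyer.BirchSwinnertonDyer.Rank1Residual.X11RankOne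
  Summit.BirchSwinnertonDyer.Rank1Residual.X11b
  Summit.BirchSwinnertonDyer.Rank1Residual.X9
  Summit.BirchSwinnertonDyer.Rank1Residual.X1
  Summit.BirchSwinnertonDyer.Rank1Residual.Supersingular

namespace Summit.BirchSwinnertonDyer.BirchSwinnertonDyer.Theorems

/-- `#{Ẽ'(𝔽_5)} = 6` for the CM partner `[0,0,0,0,4] : y² = x³ + 4` (`j = 0`, conductor `108`) (`a_5 = 0`: good SUPERSINGULAR; kernel count). [folklore] -/
theorem card_cm0p4_5 :
    Nat.card (((⟨0, 0, 0, 0, 4⟩ : WeierstrassCurve ℤ).map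
      (Int.castRingHom (ZMod 5))).toAffine.Point) = 6 := by
  rw [@WeierstrassCurve.natCard_point_eq_one_add_card (ZMod 5) (@ZMod.instField 5 ⟨by norm_num⟩) _ _ _
    (by decide +kernel), @card_sol_eq_sum_euler (ZMod 5) (@ZMod.instField 5 ⟨by norm_num⟩) _ _
    (by rw [ZMod.ringChar_zmod_n]; decide), ZMod.card]
  decide +kernel

/-- The CM partner `[0,0,0,0,4] : y² = x³ + 4` (`j = 0`, conductor `108`) is an elliptic curve (`Δ ≠ 0`, kernel). [folklore] -/
theorem isElliptic_cm0p4 : (⟨0, 0, 0, 0, 4⟩ : WeierstrassCurve ℚ).IsElliptic :=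
  isElliptic_of_discOf_ne_zero 0 0 0 0 4 (by decide +kernel)

/-- The CM partner `[0,0,0,0,4] : y² = x³ + 4` (`j = 0`, conductor `108`) is globally minimal (Kraus' bounded criterion, kernel). [cite: SilvermanAEC2009, VII.1 Remark 1.1] -/
theorem isGloballyMinimal_cm0p4 : (⟨0, 0, 0, 0, 4⟩ : WeierstrassCurve ℚ).IsGloballyMinimal :=
  isGloballyMinimal_of_krausCriterion_bounded₂ 0 0 0 0 4 (by decide +kernel) (by decide +kernel)
    (by decide +kernel)

/-- The CM partner `[0,0,0,0,4] : y² = x³ + 4` (`j = 0`, conductor `108`) has CM (`j = 0 ∈` the thirteen CM values), for any globally minimal `A` with this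
integral model. [cite: SilvermanAEC2009, App. C §11] -/
theorem hasCM_cm0p4 {A : WeierstrassCurve ℚ} [A.IsElliptic] [A.IsGloballyMinimal]
    (hIA : integralModelInt A = ⟨0, 0, 0, 0, 4⟩) : A.HasCM :=
  (hasCM_iff_j_mem_holds A).mpr (by rw [j_eq_of_intModel 0 0 0 0 4 hIA]; decide +kernel)

/-- `#{Ẽ'(𝔽_5)} = 6` for the CM partner `[0,0,0,0,−1372] : y² = x³ − 2²·7³` (`j = 0`, conductor `5292`) (`a_5 = 0`: good SUPERSINGULAR; kernel count). [folklore] -/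
theorem card_cm0m1372_5 :
    Nat.card (((⟨0, 0, 0, 0, -1372⟩ : WeierstrassCurve ℤ).map
      (Int.castRingHom (ZMod 5))).toAffine.Point) = 6 := by
  rw [@WeierstrassCurve.natCard_point_eq_one_add_card (ZMod 5) (@ZMod.instField 5 ⟨by norm_num⟩) _ _ _
    (by decide +kernel), @card_sol_eq_sum_euler (ZMod 5) (@ZMod.instField 5 ⟨by norm_num⟩) _ _
    (by rw [ZMod.ringChar_zmod_n]; decide), ZMod.card]
  decide +kernel

/-- The CM partner `[0,0,0,0,−1372] : y² = x³ − 2²·7³` (`j = 0`, conductor `5292`) is an elliptic curve (`Δ ≠ 0`, kernel). [folklore] -/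
theorem isElliptic_cm0m1372 : (⟨0, 0, 0, 0, -1372⟩ : WeierstrassCurve ℚ).IsElliptic :=
  isElliptic_of_discOf_ne_zero 0 0 0 0 (-1372) (by decide +kernel)

/-- The CM partner `[0,0,0,0,−1372] : y² = x³ − 2²·7³` (`j = 0`, conductor `5292`) is globally minimal (Kraus' bounded criterion, kernel). [cite: SilvermanAEC2009, VII.1 Remark 1.1] -/
theorem isGloballyMinimal_cm0m1372 : (⟨0, 0, 0, 0, -1372⟩ : WeierstrassCurve ℚ).IsGloballyMinimal :=
  isGloballyMinimal_of_krausCriterion_bounded₂ 0 0 0 0 (-1372) (by decide +kernel) (by decide +kernel)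
    (by decide +kernel)

/-- The CM partner `[0,0,0,0,−1372] : y² = x³ − 2²·7³` (`j = 0`, conductor `5292`) has CM (`j = 0 ∈` the thirteen CM values), for any globally minimal `A` with this
integral model. [cite: SilvermanAEC2009, App. C §11] -/
theorem hasCM_cm0m1372 {A : WeierstrassCurve ℚ} [A.IsElliptic] [A.IsGloballyMinimal]
    (hIA : integralModelInt A = ⟨0, 0, 0, 0, -1372⟩) : A.HasCM :=
  (hasCM_iff_j_mem_holds A).mpr (by rw [j_eq_of_intModel 0 0 0 0 (-1372) hIA]; decide +kernel)

/-- `#{Ẽ'(𝔽_5)} = 6` for the CM partner `[0,0,0,0,907924] : y² = x³ + 2²·61³` (`j = 0`, conductor `401868`) (`a_5 = 0`: good SUPERSINGULAR; kernel count). [folklore] -/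
theorem card_cm0p907924_5 :
    Nat.card (((⟨0, 0, 0, 0, 907924⟩ : WeierstrassCurve ℤ).map
      (Int.castRingHom (ZMod 5))).toAffine.Point) = 6 := by
  rw [@WeierstrassCurve.natCard_point_eq_one_add_card (ZMod 5) (@ZMod.instField 5 ⟨by norm_num⟩) _ _ _
    (by decide +kernel), @card_sol_eq_sum_euler (ZMod 5) (@ZMod.instField 5 ⟨by norm_num⟩) _ _
    (by rw [ZMod.ringChar_zmod_n]; decide), ZMod.card]
  decide +kernel

/-- The CM partner `[0,0,0,0,907924] : y² = x³ + 2²·61³` (`j = 0`, conductor `401868`) is an elliptic curve (`Δ ≠ 0`, kernel). [folklore] -/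
theorem isElliptic_cm0p907924 : (⟨0, 0, 0, 0, 907924⟩ : WeierstrassCurve ℚ).IsElliptic :=
  isElliptic_of_discOf_ne_zero 0 0 0 0 907924 (by decide +kernel)

/-- The CM partner `[0,0,0,0,907924] : y² = x³ + 2²·61³` (`j = 0`, conductor `401868`) is globally minimal (Kraus' bounded criterion, kernel). [cite: SilvermanAEC2009, VII.1 Remark 1.1] -/
theorem isGloballyMinimal_cm0p907924 : (⟨0, 0, 0, 0, 907924⟩ : WeierstrassCurve ℚ).IsGloballyMinimal :=
  isGloballyMinimal_of_krausCriterion_bounded₂ 0 0 0 0 907924 (by decide +kernel) (by decide +kernel)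
    (by decide +kernel)

/-- The CM partner `[0,0,0,0,907924] : y² = x³ + 2²·61³` (`j = 0`, conductor `401868`) has CM (`j = 0 ∈` the thirteen CM values), for any globally minimal `A` with this
integral model. [cite: SilvermanAEC2009, App. C §11] -/
theorem hasCM_cm0p907924 {A : WeierstrassCurve ℚ} [A.IsElliptic] [A.IsGloballyMinimal]
    (hIA : integralModelInt A = ⟨0, 0, 0, 0, 907924⟩) : A.HasCM :=
  (hasCM_iff_j_mem_holds A).mpr (by rw [j_eq_of_intModel 0 0 0 0 907924 hIA]; decide +kernel)

/-- `#{Ẽ'(𝔽_5)} = 6` for the CM partner `[0,0,0,0,9604] : y² = x³ + 2²·7⁴` (`j = 0`, conductor `1764`) (`a_5 = 0`: good SUPERSINGULAR; kernel count). [folklore] -/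
theorem card_cm0p9604_5 :
    Nat.card (((⟨0, 0, 0, 0, 9604⟩ : WeierstrassCurve ℤ).map
      (Int.castRingHom (ZMod 5))).toAffine.Point) = 6 := by
  rw [@WeierstrassCurve.natCard_point_eq_one_add_card (ZMod 5) (@ZMod.instField 5 ⟨by norm_num⟩) _ _ _
    (by decide +kernel), @card_sol_eq_sum_euler (ZMod 5) (@ZMod.instField 5 ⟨by norm_num⟩) _ _
    (by rw [ZMod.ringChar_zmod_n]; decide), ZMod.card]
  decide +kernel

/-- The CM partner `[0,0,0,0,9604] : y² = x³ + 2²·7⁴` (`j = 0`, conductor `1764`) is an elliptic curve (`Δ ≠ 0`, kernel). [folklore] -/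
theorem isElliptic_cm0p9604 : (⟨0, 0, 0, 0, 9604⟩ : WeierstrassCurve ℚ).IsElliptic :=
  isElliptic_of_discOf_ne_zero 0 0 0 0 9604 (by decide +kernel)

/-- The CM partner `[0,0,0,0,9604] : y² = x³ + 2²·7⁴` (`j = 0`, conductor `1764`) is globally minimal (Kraus' bounded criterion, kernel). [cite: SilvermanAEC2009, VII.1 Remark 1.1] -/
theorem isGloballyMinimal_cm0p9604 : (⟨0, 0, 0, 0, 9604⟩ : WeierstrassCurve ℚ).IsGloballyMinimal :=
  isGloballyMinimal_of_krausCriterion_bounded₂ 0 0 0 0 9604 (by decide +kernel) (by decide +kernel)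
    (by decide +kernel)

/-- The CM partner `[0,0,0,0,9604] : y² = x³ + 2²·7⁴` (`j = 0`, conductor `1764`) has CM (`j = 0 ∈` the thirteen CM values), for any globally minimal `A` with this
integral model. [cite: SilvermanAEC2009, App. C §11] -/
theorem hasCM_cm0p9604 {A : WeierstrassCurve ℚ} [A.IsElliptic] [A.IsGloballyMinimal]
    (hIA : integralModelInt A = ⟨0, 0, 0, 0, 9604⟩) : A.HasCM :=
  (hasCM_iff_j_mem_holds A).mpr (by rw [j_eq_of_intModel 0 0 0 0 9604 hIA]; decide +kernel)

/-- `#{Ẽ(𝔽_5)} = 6` for the Cremona model of `197748b1` (`a_5 = 0`: good SUPERSINGULAR; kernel count).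
[cite: Cremona2006, Table 1 (Cremona label 197748b1)] -/
theorem card_c197748b1_5 :
    Nat.card (((⟨0, 0, 0, -23626215, 46838410542⟩ : WeierstrassCurve ℤ).map
      (Int.castRingHom (ZMod 5))).toAffine.Point) = 6 := by
  rw [@WeierstrassCurve.natCard_point_eq_one_add_card (ZMod 5) (@ZMod.instField 5 ⟨by norm_num⟩) _ _ _
    (by decide +kernel), @card_sol_eq_sum_euler (ZMod 5) (@ZMod.instField 5 ⟨by norm_num⟩) _ _
    (by rw [ZMod.ringChar_zmod_n]; decide), ZMod.card]
  decide +kernel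

/-- **Kobayashi's ± main conjecture, BOTH signs, for `197748b1 @ 5`** (Cremona model `[0, 0, 0, -23626215, 46838410542]`, `N = 197748 = 2²·3³·1831`,
`r_an = 0`; item-4 pair: X7, `a_5 = 0`, image `5Nn`) **by CM-congruence transfer from `E' =` `[0,0,0,0,4] : y² = x³ + 4` (`j = 0`, conductor `108`), MODULO the OPEN
binder `hCL` (Corpuz–Lei 2025, PRE)**: `E ≅_ℚ` the member `(λ:μ) = (12:1)` of the indirect family `X⁻_{E'}(5)`, `u = 2293235712` (`fiveCongruent_of_hesseIndCertificate`, modulo Fisher 2013 Thm. 5.8 `hF'`); covariant identities by `norm_num`. BY NAME: `hPR`, `h5`, `h3`, `hF'`.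
Certificate binder `hL'`: `L(E',1)/Ω(E') = 1/3` (engines PARI kit j250436 / PARI-free modular symbols kit j251201), a `5`-unit (kernel).
Kernel-decided (models as instance binders): `5 ∤ Δ` (both), `#Ẽ(𝔽_5) = #Ẽ'(𝔽_5) = 6`, CM of `E'`. Per pair; item 4 stays OPEN; nothing booked.
[claim: CorpuzLei2025, status: under-review] [cite: PollackRubin2004, Theorem (p. 448) = Thm. 7.3]
[cite: Fisher2013QuinticTwists, Thm. 5.8] [cite: Cremona2006, Table 1 (Cremona label 197748b1)] -/
theorem kobayashiMainConjecture_c197748b1_5_of_transfer_OPEN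
    (hCL : CorpuzLei2025_signedMainConjecture_transfer_OPEN)
    (hPR : PollackRubin2004.mainTheorem_signedCharIdeal_eq_of_cm)
    (h5 : realPeriodRat_eq_unit_mul_plusPeriod) (h3 : realPeriodRat_eq_unit_mul_plusPeriod_three)
    (hF' : thm58_fiveCongruent_hessePencilInd)
    (W A : WeierstrassCurve ℚ) [W.IsElliptic] [W.IsGloballyMinimal] [A.IsElliptic] [A.IsGloballyMinimal]
    [Fact (Nat.Prime 5)] (hW : W = ⟨0, 0, 0, -23626215, 46838410542⟩) (hA : A = ⟨0, 0, 0, 0, 4⟩)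
    (hL' : A.entireLFunction 1 / (A.realPeriodRat : ℂ) = ((1 / 3 : ℚ) : ℂ)) (ε : ℤˣ) :
    KobayashiMainConjecture W 5 ε := by
  have hIW : integralModelInt W = ⟨0, 0, 0, -23626215, 46838410542⟩ :=
    integralModelInt_eq_of_map_eq _ (by rw [hW]; ext <;> simp [WeierstrassCurve.map])
  have hIA : integralModelInt A = ⟨0, 0, 0, 0, 4⟩ :=
    integralModelInt_eq_of_map_eq _ (by rw [hA]; ext <;> simp [WeierstrassCurve.map])
  have hΔ : (⟨0, 0, 0, -23626215, 46838410542⟩ : WeierstrassCurve ℤ).Δ = discOf [0, 0, 0, -23626215, 46838410542] :=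
    intCurve_Δ 0 0 0 (-23626215) 46838410542
  have hΔA : (⟨0, 0, 0, 0, 4⟩ : WeierstrassCurve ℤ).Δ = discOf [0, 0, 0, 0, 4] :=
    intCurve_Δ 0 0 0 0 4
  have hgood : W.HasGoodReductionAtPrime 5 :=
    hasGoodReductionAtPrime_of_not_dvd W 5 (by rw [minimalDiscriminantInt_eq hIW, hΔ]; decide +kernel)
  have hgoodA : A.HasGoodReductionAtPrime 5 :=
    hasGoodReductionAtPrime_of_not_dvd A 5 (by rw [minimalDiscriminantInt_eq hIA, hΔA]; decide +kernel)
  have hap : W.frobeniusTrace 5 = 0 := by rw [frobeniusTrace_eq hIW card_c197748b1_5]; norm_num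
  have hapA : A.frobeniusTrace 5 = 0 := by rw [frobeniusTrace_eq hIA card_cm0p4_5]; norm_num
  have hc4 : W.c₄ = (1134058320 : ℚ) := by
    subst hW; norm_num [WeierstrassCurve.c₄, WeierstrassCurve.b₂, WeierstrassCurve.b₄]
  have hc6 : W.c₆ = (-40468386708288 : ℚ) := by
    subst hW; norm_num [WeierstrassCurve.c₆, WeierstrassCurve.b₂, WeierstrassCurve.b₄, WeierstrassCurve.b₆]
  have hc4A : A.c₄ = (0 : ℚ) := by
    subst hA; norm_num [WeierstrassCurve.c₄, WeierstrassCurve.b₂, WeierstrassCurve.b₄]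
  have hc6A : A.c₆ = (-3456 : ℚ) := by
    subst hA; norm_num [WeierstrassCurve.c₆, WeierstrassCurve.b₂, WeierstrassCurve.b₄, WeierstrassCurve.b₆]
  have hiso := fiveCongruent_of_hesseIndCertificate hF' A W (12 : ℚ) 1 (2293235712 : ℚ)
    (by norm_num) (by rw [hc4A, hc6A, hc4, eval_hesseC4ind]; norm_num)
    (by rw [hc4A, hc6A, hc6, eval_hesseC6ind]; norm_num)
  exact kobayashiMainConjecture_of_cmPartner_of_lvalue_of_transfer_OPEN W A 5 hCL hPR h5 h3 (by norm_num)
    hgood hap (hasCM_cm0p4 hIA) hgoodA hapA hiso (by norm_num) hL'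
    (by rw [show ((1 : ℚ) / 3) = ((1 : ℕ) : ℚ) / (3 : ℕ) by norm_num]
        exact padicValRat_natCast_div_natCast_eq_zero 5 1 3 (by norm_num) (by norm_num)) ε

/-- `#{Ẽ(𝔽_5)} = 6` for the Cremona model of `322812m1` (`a_5 = 0`: good SUPERSINGULAR; kernel count).
[cite: Cremona2006, Table 1 (Cremona label 322812m1)] -/
theorem card_c322812m1_5 :
    Nat.card (((⟨0, 0, 0, -235128705, 1387735158957⟩ : WeierstrassCurve ℤ).map
      (Int.castRingHom (ZMod 5))).toAffine.Point) = 6 := by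
  rw [@WeierstrassCurve.natCard_point_eq_one_add_card (ZMod 5) (@ZMod.instField 5 ⟨by norm_num⟩) _ _ _
    (by decide +kernel), @card_sol_eq_sum_euler (ZMod 5) (@ZMod.instField 5 ⟨by norm_num⟩) _ _
    (by rw [ZMod.ringChar_zmod_n]; decide), ZMod.card]
  decide +kernel

/-- **Kobayashi's ± main conjecture, BOTH signs, for `322812m1 @ 5`** (Cremona model `[0, 0, 0, -235128705, 1387735158957]`, `N = 322812 = 2²·3³·7²·61`,
`r_an = 0`; item-4 pair: X7, `a_5 = 0`, image `5Nn`) **by CM-congruence transfer from `E' =` `[0,0,0,0,−1372] : y² = x³ − 2²·7³` (`j = 0`, conductor `5292`), MODULO the OPEN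
binder `hCL` (Corpuz–Lei 2025, PRE)**: `E ≅_ℚ` the member `(λ:μ) = (-336:1)` of the Hesse pencil `X_{E'}(5)`, `u = 535311286272` (`fiveCongruent_of_hesseCertificate`, modulo Fisher 2012 Thm. 13.2 `hF`); covariant identities by `norm_num`. BY NAME: `hPR`, `h5`, `h3`, `hF`.
Certificate binder `hL'`: `L(E',1)/Ω(E') = 3` (engines PARI kit j250436 / PARI-free modular symbols kit j251201), a `5`-unit (kernel).
Kernel-decided (models as instance binders): `5 ∤ Δ` (both), `#Ẽ(𝔽_5) = #Ẽ'(𝔽_5) = 6`, CM of `E'`. Per pair; item 4 stays OPEN; nothing booked.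
[claim: CorpuzLei2025, status: under-review] [cite: PollackRubin2004, Theorem (p. 448) = Thm. 7.3]
[cite: Fisher2012Hessian, Thm. 13.2 (n = 5)] [cite: Cremona2006, Table 1 (Cremona label 322812m1)] -/
theorem kobayashiMainConjecture_c322812m1_5_of_transfer_OPEN
    (hCL : CorpuzLei2025_signedMainConjecture_transfer_OPEN)
    (hPR : PollackRubin2004.mainTheorem_signedCharIdeal_eq_of_cm)
    (h5 : realPeriodRat_eq_unit_mul_plusPeriod) (h3 : realPeriodRat_eq_unit_mul_plusPeriod_three)
    (hF : thm132_fiveCongruent_hessePencil)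
    (W A : WeierstrassCurve ℚ) [W.IsElliptic] [W.IsGloballyMinimal] [A.IsElliptic] [A.IsGloballyMinimal]
    [Fact (Nat.Prime 5)] (hW : W = ⟨0, 0, 0, -235128705, 1387735158957⟩) (hA : A = ⟨0, 0, 0, 0, -1372⟩)
    (hL' : A.entireLFunction 1 / (A.realPeriodRat : ℂ) = ((3 : ℚ) : ℂ)) (ε : ℤˣ) :
    KobayashiMainConjecture W 5 ε := by
  have hIW : integralModelInt W = ⟨0, 0, 0, -235128705, 1387735158957⟩ :=
    integralModelInt_eq_of_map_eq _ (by rw [hW]; ext <;> simp [WeierstrassCurve.map])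
  have hIA : integralModelInt A = ⟨0, 0, 0, 0, -1372⟩ :=
    integralModelInt_eq_of_map_eq _ (by rw [hA]; ext <;> simp [WeierstrassCurve.map])
  have hΔ : (⟨0, 0, 0, -235128705, 1387735158957⟩ : WeierstrassCurve ℤ).Δ = discOf [0, 0, 0, -235128705, 1387735158957] :=
    intCurve_Δ 0 0 0 (-235128705) 1387735158957
  have hΔA : (⟨0, 0, 0, 0, -1372⟩ : WeierstrassCurve ℤ).Δ = discOf [0, 0, 0, 0, -1372] :=
    intCurve_Δ 0 0 0 0 (-1372)
  have hgood : W.HasGoodReductionAtPrime 5 :=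
    hasGoodReductionAtPrime_of_not_dvd W 5 (by rw [minimalDiscriminantInt_eq hIW, hΔ]; decide +kernel)
  have hgoodA : A.HasGoodReductionAtPrime 5 :=
    hasGoodReductionAtPrime_of_not_dvd A 5 (by rw [minimalDiscriminantInt_eq hIA, hΔA]; decide +kernel)
  have hap : W.frobeniusTrace 5 = 0 := by rw [frobeniusTrace_eq hIW card_c322812m1_5]; norm_num
  have hapA : A.frobeniusTrace 5 = 0 := by rw [frobeniusTrace_eq hIA card_cm0m1372_5]; norm_num
  have hc4 : W.c₄ = (11286177840 : ℚ) := by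
    subst hW; norm_num [WeierstrassCurve.c₄, WeierstrassCurve.b₂, WeierstrassCurve.b₄]
  have hc6 : W.c₆ = (-1199003177338848 : ℚ) := by
    subst hW; norm_num [WeierstrassCurve.c₆, WeierstrassCurve.b₂, WeierstrassCurve.b₄, WeierstrassCurve.b₆]
  have hc4A : A.c₄ = (0 : ℚ) := by
    subst hA; norm_num [WeierstrassCurve.c₄, WeierstrassCurve.b₂, WeierstrassCurve.b₄]
  have hc6A : A.c₆ = (1185408 : ℚ) := by
    subst hA; norm_num [WeierstrassCurve.c₆, WeierstrassCurve.b₂, WeierstrassCurve.b₄, WeierstrassCurve.b₆]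
  have hiso := fiveCongruent_of_hesseCertificate hF A W (-336 : ℚ) 1 (535311286272 : ℚ)
    (by norm_num) (by rw [hc4A, hc6A, hc4, eval_hesseC4]; norm_num)
    (by rw [hc4A, hc6A, hc6, eval_hesseC6]; norm_num)
  exact kobayashiMainConjecture_of_cmPartner_of_lvalue_of_transfer_OPEN W A 5 hCL hPR h5 h3 (by norm_num)
    hgood hap (hasCM_cm0m1372 hIA) hgoodA hapA hiso (by norm_num) hL'
    (by rw [show (3 : ℚ) = ((3 : ℕ) : ℚ) / (1 : ℕ) by norm_num]
        exact padicValRat_natCast_div_natCast_eq_zero 5 3 1 (by norm_num) (by norm_num)) ε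

/-- `#{Ẽ(𝔽_5)} = 6` for the Cremona model of `401868k1` (`a_5 = 0`: good SUPERSINGULAR; kernel count).
[cite: Cremona2006, Table 1 (Cremona label 401868k1)] -/
theorem card_c401868k1_5 :
    Nat.card (((⟨0, 0, 0, -160698473505, 24795092947845213⟩ : WeierstrassCurve ℤ).map
      (Int.castRingHom (ZMod 5))).toAffine.Point) = 6 := by
  rw [@WeierstrassCurve.natCard_point_eq_one_add_card (ZMod 5) (@ZMod.instField 5 ⟨by norm_num⟩) _ _ _
    (by decide +kernel), @card_sol_eq_sum_euler (ZMod 5) (@ZMod.instField 5 ⟨by norm_num⟩) _ _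
    (by rw [ZMod.ringChar_zmod_n]; decide), ZMod.card]
  decide +kernel

/-- **Kobayashi's ± main conjecture, BOTH signs, for `401868k1 @ 5`** (Cremona model `[0, 0, 0, -160698473505, 24795092947845213]`, `N = 401868 = 2²·3³·61²`,
`r_an = 0`; item-4 pair: X7, `a_5 = 0`, image `5Nn`) **by CM-congruence transfer from `E' =` `[0,0,0,0,907924] : y² = x³ + 2²·61³` (`j = 0`, conductor `401868`), MODULO the OPEN
binder `hCL` (Corpuz–Lei 2025, PRE)**: `E ≅_ℚ` the member `(λ:μ) = (-1464:1)` of the indirect family `X⁻_{E'}(5)`, `u = 1758520225667706192396288` (`fiveCongruent_of_hesseIndCertificate`, modulo Fisher 2013 Thm. 5.8 `hF'`); covariant identities by `norm_num`. BY NAME: `hPR`, `h5`, `h3`, `hF'`.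
Certificate binder `hL'`: `L(E',1)/Ω(E') = 1` (engines PARI kit j250436 / PARI-free modular symbols kit j251201), a `5`-unit (kernel).
Kernel-decided (models as instance binders): `5 ∤ Δ` (both), `#Ẽ(𝔽_5) = #Ẽ'(𝔽_5) = 6`, CM of `E'`. Per pair; item 4 stays OPEN; nothing booked.
[claim: CorpuzLei2025, status: under-review] [cite: PollackRubin2004, Theorem (p. 448) = Thm. 7.3]
[cite: Fisher2013QuinticTwists, Thm. 5.8] [cite: Cremona2006, Table 1 (Cremona label 401868k1)] -/
theorem kobayashiMainConjecture_c401868k1_5_of_transfer_OPEN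
    (hCL : CorpuzLei2025_signedMainConjecture_transfer_OPEN)
    (hPR : PollackRubin2004.mainTheorem_signedCharIdeal_eq_of_cm)
    (h5 : realPeriodRat_eq_unit_mul_plusPeriod) (h3 : realPeriodRat_eq_unit_mul_plusPeriod_three)
    (hF' : thm58_fiveCongruent_hessePencilInd)
    (W A : WeierstrassCurve ℚ) [W.IsElliptic] [W.IsGloballyMinimal] [A.IsElliptic] [A.IsGloballyMinimal]
    [Fact (Nat.Prime 5)] (hW : W = ⟨0, 0, 0, -160698473505, 24795092947845213⟩) (hA : A = ⟨0, 0, 0, 0, 907924⟩)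
    (hL' : A.entireLFunction 1 / (A.realPeriodRat : ℂ) = ((1 : ℚ) : ℂ)) (ε : ℤˣ) :
    KobayashiMainConjecture W 5 ε := by
  have hIW : integralModelInt W = ⟨0, 0, 0, -160698473505, 24795092947845213⟩ :=
    integralModelInt_eq_of_map_eq _ (by rw [hW]; ext <;> simp [WeierstrassCurve.map])
  have hIA : integralModelInt A = ⟨0, 0, 0, 0, 907924⟩ :=
    integralModelInt_eq_of_map_eq _ (by rw [hA]; ext <;> simp [WeierstrassCurve.map])
  have hΔ : (⟨0, 0, 0, -160698473505, 24795092947845213⟩ : WeierstrassCurve ℤ).Δ = discOf [0, 0, 0, -160698473505, 24795092947845213] :=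
    intCurve_Δ 0 0 0 (-160698473505) 24795092947845213
  have hΔA : (⟨0, 0, 0, 0, 907924⟩ : WeierstrassCurve ℤ).Δ = discOf [0, 0, 0, 0, 907924] :=
    intCurve_Δ 0 0 0 0 907924
  have hgood : W.HasGoodReductionAtPrime 5 :=
    hasGoodReductionAtPrime_of_not_dvd W 5 (by rw [minimalDiscriminantInt_eq hIW, hΔ]; decide +kernel)
  have hgoodA : A.HasGoodReductionAtPrime 5 :=
    hasGoodReductionAtPrime_of_not_dvd A 5 (by rw [minimalDiscriminantInt_eq hIA, hΔA]; decide +kernel)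
  have hap : W.frobeniusTrace 5 = 0 := by rw [frobeniusTrace_eq hIW card_c401868k1_5]; norm_num
  have hapA : A.frobeniusTrace 5 = 0 := by rw [frobeniusTrace_eq hIA card_cm0p907924_5]; norm_num
  have hc4 : W.c₄ = (7713526728240 : ℚ) := by
    subst hW; norm_num [WeierstrassCurve.c₄, WeierstrassCurve.b₂, WeierstrassCurve.b₄]
  have hc6 : W.c₆ = (-21422960306938264032 : ℚ) := by
    subst hW; norm_num [WeierstrassCurve.c₆, WeierstrassCurve.b₂, WeierstrassCurve.b₄, WeierstrassCurve.b₆]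
  have hc4A : A.c₄ = (0 : ℚ) := by
    subst hA; norm_num [WeierstrassCurve.c₄, WeierstrassCurve.b₂, WeierstrassCurve.b₄]
  have hc6A : A.c₆ = (-784446336 : ℚ) := by
    subst hA; norm_num [WeierstrassCurve.c₆, WeierstrassCurve.b₂, WeierstrassCurve.b₄, WeierstrassCurve.b₆]
  have hiso := fiveCongruent_of_hesseIndCertificate hF' A W (-1464 : ℚ) 1 (1758520225667706192396288 : ℚ)
    (by norm_num) (by rw [hc4A, hc6A, hc4, eval_hesseC4ind]; norm_num)
    (by rw [hc4A, hc6A, hc6, eval_hesseC6ind]; norm_num)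
  exact kobayashiMainConjecture_of_cmPartner_of_lvalue_of_transfer_OPEN W A 5 hCL hPR h5 h3 (by norm_num)
    hgood hap (hasCM_cm0p907924 hIA) hgoodA hapA hiso (by norm_num) hL'
    (by rw [show (1 : ℚ) = ((1 : ℕ) : ℚ) / (1 : ℕ) by norm_num]
        exact padicValRat_natCast_div_natCast_eq_zero 5 1 1 (by norm_num) (by norm_num)) ε

/-- `#{Ẽ(𝔽_5)} = 6` for the Cremona model of `421596m1` (`a_5 = 0`: good SUPERSINGULAR; kernel count).
[cite: Cremona2006, Table 1 (Cremona label 421596m1)] -/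
theorem card_c421596m1_5 :
    Nat.card (((⟨0, 0, 0, -4382258895, 111659601522294⟩ : WeierstrassCurve ℤ).map
      (Int.castRingHom (ZMod 5))).toAffine.Point) = 6 := by
  rw [@WeierstrassCurve.natCard_point_eq_one_add_card (ZMod 5) (@ZMod.instField 5 ⟨by norm_num⟩) _ _ _
    (by decide +kernel), @card_sol_eq_sum_euler (ZMod 5) (@ZMod.instField 5 ⟨by norm_num⟩) _ _
    (by rw [ZMod.ringChar_zmod_n]; decide), ZMod.card]
  decide +kernel

/-- **Kobayashi's ± main conjecture, BOTH signs, for `421596m1 @ 5`** (Cremona model `[0, 0, 0, -4382258895, 111659601522294]`, `N = 421596 = 2²·3²·7²·239`,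
`r_an = 0`; item-4 pair: X7, `a_5 = 0`, image `5Nn`) **by CM-congruence transfer from `E' =` `[0,0,0,0,9604] : y² = x³ + 2²·7⁴` (`j = 0`, conductor `1764`), MODULO the OPEN
binder `hCL` (Corpuz–Lei 2025, PRE)**: `E ≅_ℚ` the member `(λ:μ) = (168:1)` of the Hesse pencil `X_{E'}(5)`, `u = 1204450394112` (`fiveCongruent_of_hesseCertificate`, modulo Fisher 2012 Thm. 13.2 `hF`); covariant identities by `norm_num`. BY NAME: `hPR`, `h5`, `h3`, `hF`.
Certificate binder `hL'`: `L(E',1)/Ω(E') = 2` (engines PARI kit j250436 / PARI-free modular symbols kit j251201), a `5`-unit (kernel).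
Kernel-decided (models as instance binders): `5 ∤ Δ` (both), `#Ẽ(𝔽_5) = #Ẽ'(𝔽_5) = 6`, CM of `E'`. Per pair; item 4 stays OPEN; nothing booked.
[claim: CorpuzLei2025, status: under-review] [cite: PollackRubin2004, Theorem (p. 448) = Thm. 7.3]
[cite: Fisher2012Hessian, Thm. 13.2 (n = 5)] [cite: Cremona2006, Table 1 (Cremona label 421596m1)] -/
theorem kobayashiMainConjecture_c421596m1_5_of_transfer_OPEN
    (hCL : CorpuzLei2025_signedMainConjecture_transfer_OPEN)
    (hPR : PollackRubin2004.mainTheorem_signedCharIdeal_eq_of_cm)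
    (h5 : realPeriodRat_eq_unit_mul_plusPeriod) (h3 : realPeriodRat_eq_unit_mul_plusPeriod_three)
    (hF : thm132_fiveCongruent_hessePencil)
    (W A : WeierstrassCurve ℚ) [W.IsElliptic] [W.IsGloballyMinimal] [A.IsElliptic] [A.IsGloballyMinimal]
    [Fact (Nat.Prime 5)] (hW : W = ⟨0, 0, 0, -4382258895, 111659601522294⟩) (hA : A = ⟨0, 0, 0, 0, 9604⟩)
    (hL' : A.entireLFunction 1 / (A.realPeriodRat : ℂ) = ((2 : ℚ) : ℂ)) (ε : ℤˣ) :
    KobayashiMainConjecture W 5 ε := by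
  have hIW : integralModelInt W = ⟨0, 0, 0, -4382258895, 111659601522294⟩ :=
    integralModelInt_eq_of_map_eq _ (by rw [hW]; ext <;> simp [WeierstrassCurve.map])
  have hIA : integralModelInt A = ⟨0, 0, 0, 0, 9604⟩ :=
    integralModelInt_eq_of_map_eq _ (by rw [hA]; ext <;> simp [WeierstrassCurve.map])
  have hΔ : (⟨0, 0, 0, -4382258895, 111659601522294⟩ : WeierstrassCurve ℤ).Δ = discOf [0, 0, 0, -4382258895, 111659601522294] :=
    intCurve_Δ 0 0 0 (-4382258895) 111659601522294
  have hΔA : (⟨0, 0, 0, 0, 9604⟩ : WeierstrassCurve ℤ).Δ = discOf [0, 0, 0, 0, 9604] :=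
    intCurve_Δ 0 0 0 0 9604
  have hgood : W.HasGoodReductionAtPrime 5 :=
    hasGoodReductionAtPrime_of_not_dvd W 5 (by rw [minimalDiscriminantInt_eq hIW, hΔ]; decide +kernel)
  have hgoodA : A.HasGoodReductionAtPrime 5 :=
    hasGoodReductionAtPrime_of_not_dvd A 5 (by rw [minimalDiscriminantInt_eq hIA, hΔA]; decide +kernel)
  have hap : W.frobeniusTrace 5 = 0 := by rw [frobeniusTrace_eq hIW card_c421596m1_5]; norm_num
  have hapA : A.frobeniusTrace 5 = 0 := by rw [frobeniusTrace_eq hIA card_cm0p9604_5]; norm_num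
  have hc4 : W.c₄ = (210348426960 : ℚ) := by
    subst hW; norm_num [WeierstrassCurve.c₄, WeierstrassCurve.b₂, WeierstrassCurve.b₄]
  have hc6 : W.c₆ = (-96473895715262016 : ℚ) := by
    subst hW; norm_num [WeierstrassCurve.c₆, WeierstrassCurve.b₂, WeierstrassCurve.b₄, WeierstrassCurve.b₆]
  have hc4A : A.c₄ = (0 : ℚ) := by
    subst hA; norm_num [WeierstrassCurve.c₄, WeierstrassCurve.b₂, WeierstrassCurve.b₄]
  have hc6A : A.c₆ = (-8297856 : ℚ) := by
    subst hA; norm_num [WeierstrassCurve.c₆, WeierstrassCurve.b₂, WeierstrassCurve.b₄, WeierstrassCurve.b₆]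
  have hiso := fiveCongruent_of_hesseCertificate hF A W (168 : ℚ) 1 (1204450394112 : ℚ)
    (by norm_num) (by rw [hc4A, hc6A, hc4, eval_hesseC4]; norm_num)
    (by rw [hc4A, hc6A, hc6, eval_hesseC6]; norm_num)
  exact kobayashiMainConjecture_of_cmPartner_of_lvalue_of_transfer_OPEN W A 5 hCL hPR h5 h3 (by norm_num)
    hgood hap (hasCM_cm0p9604 hIA) hgoodA hapA hiso (by norm_num) hL'
    (by rw [show (2 : ℚ) = ((2 : ℕ) : ℚ) / (1 : ℕ) by norm_num]
        exact padicValRat_natCast_div_natCast_eq_zero 5 2 1 (by norm_num) (by norm_num)) ε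

end Summit.BirchSwinnertonDyer.BirchSwinnertonDyer.Theorems

end
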